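import Summits.BirchSwinnertonDyer.Rank1Residual.Additive.TameBranchAnalyticShaConverseTwins
import HarnessLib

/-!
# `BSD(E,p)` ⟺ THE MAIN CONJECTURE AT THE PAIR on the (M) and X3 twins — the class-level MASTER
# (Kato / Wuthrich element `g`, Delbourgo's `ℓ`, `ord_p #Ш[p^∞] + ord_p ℓ ≤ ord_p #Ш_an`, `=` iff `g`
# generates) and the two directions gen 32 part 8 left implicit: `BSD(E,p)` ⟹ MC(pair), and MC(pair)
# ⟹ `BSD(E,p)` off the anomalous rows, on X4(M) ∩ {`ρ̄` onto} and X3♯(M), EVERY odd `p`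
# (cell `b2b-bsdres`, sub-cell additive-p2 = X3♯(G-ord)/X4♯(G-ord), gen 33; part 6a)

HONEST FRAMING (cell `b2b-bsdres`, run/shared/lean/b2b/bsd-rank1-residual/, verbatim in every
file): the goal of the cell is to DELETE the COMBINATION-SHAPED residual classes of the
Birch–Swinnerton-Dyer formula for ALL analytic-rank `≤ 1` elliptic curves over `ℚ` — "full BSD
formula for every rank `≤ 1` curve in class `C`" assembled STRICTLY from published theorems — so
that the rank-`≤ 1` remainder becomes exactly the CONSTRUCTION-SHAPED classes, which are TYPED
(missing-input `Prop`s), NOT attempted. This is not "finishing BSD". Sub-cell additive-p2: the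
classes X3♯(G-ord) / X4♯(G-ord) (and the (M) twins borrowed from additive-p1 / n1011) are
CONSTRUCTION-SHAPED and stay so; labels / RESIDUAL-MAP marks UNCHANGED; nothing is booked (`BSD(E,p)`
and "the element generates" enter ONLY as hypotheses of the two directions). Theorems only; published
inputs are explicit binders (`hK` Kato 2004 Thm. 17.4 (3), `hWu` Wuthrich 2014 Thm. 16, `hGZK`, `hmod`,
the (B)-datum `LeadingTermClauses W p Dh` = `mainTheorem_potMult` / A175 / `mainTheorem_three`). No
definition, no named fact, no `sorry`.

## What and why

Gen 32 part 6 gave the rank-0 dichotomy on X4♯(G-ord, `e = 2`) ∩ {`ρ̄` onto} (`p ≥ 5`; gen 33 parts 1–2: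
every odd `p`) in THREE forms — the master (`≤`, `=` iff generates), `BSD(E,p)` ⟹ MC(pair), MC(pair) ⟹
`BSD(E,p)` off anomalous — but on the (M) / X3 twins (part 8) only the CLOSURE form "lower bound ⟹
everything". THIS FILE supplies the missing two forms there, from gen 32's series-agnostic per-datum
`padicVal_sha_add_le_and_iff_of_iota_eq_C_mul` and the bricks already used by part 8
(`isTorsion_and_exists_iota_eq_of_katoHalf` / `_of_wuthrichHalf`, the (M) dictionary
`valuation_constantCoeff_branchMult_add_eq_padicValRat_shaAn_add`, the (G-ord) dictionary of part 1):

* §1 X4(M) ∩ {`ρ̄` onto}: `ClassX4M.padicVal_sha_add_le_shaAn_and_iff_rankZero` (MASTER),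
  `…charIdeal_eq_span_kato_of_bsdp_rankZero` (**`BSD(E,p)` ⟹ the Kato element generates**),
  `…bsdp_of_charIdeal_eq_span_kato_rankZero` (**MC(pair) ⟹ `BSD(E,p)` off the anomalous rows**);
* §2 X3♯(M): the same three for the Wuthrich element (`E[p]` reducible; no image hypothesis);
* the X3♯(G-ord, `e = 2`) ∩ `I₀*` twins are in the sibling `TameBranchAnalyticShaConverseTwinsIffGord.lean`.

So on all four defect-2 cells of the sub-cell's census, at every odd `p`, **`BSD(E,p)` and Delbourgo's main
conjecture at the pair are ONE statement up to `ℓ_p`** (`BSD ⟹ MC ∧ ℓ = 1`; `MC ⟹ BSD` off anomalous);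
the `p ∤ #Ш_an` rows have both (gen 32), the `p ∣ #Ш_an` rows get both from ONE `p`-Selmer class (part 4).
Nothing booked; labels UNCHANGED.

References: Kato 2004 Thm. 17.4 (3) [Kato2004Asterisque]; Wuthrich 2014 Thm. 16, Lemma 20 [Wuthrich2014];
Delbourgo 2002 Thm. (A), (B), p. 39 [Delbourgo2002]; Greenberg–Vatsal 2000 p. 4 [GreenbergVatsal2000];
Mazur–Tate–Teitelbaum 1986 §I.8, §I.10, §I.13 [MazurTateTeitelbaum1986Invent]; Miller 2011 Def. 1.1
[Miller2011LMS]; gen 32 parts 4, 5, 8. -/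

set_option autoImplicit false

noncomputable section

open scoped Classical MatrixGroups ModularForm NumberField

open CongruenceSubgroup IsDedekindDomain WeierstrassCurve NumberField
  Literature.NumberTheory.EllipticCurves
  Literature.NumberTheory.EllipticCurves.ModularForms
  Literature.NumberTheory.EllipticCurves.Rank1Residual
  Literature.NumberTheory.EllipticCurves.Rank1Residual.Typed
  Literature.NumberTheory.EllipticCurves.Delbourgo2002
  Literature.NumberTheory.GaloisRepresentations
  Summit.BirchSwinnertonDyer.Rank1Residual.AdditivePotMult
  Summit.BirchSwinnertonDyer.Rank1Residual.X1.MuLambda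
  Summit.BirchSwinnertonDyer.Rank1Residual.X1.RankOneParitySqueeze
  Summit.BirchSwinnertonDyer.Rank1Residual.X11a.LambdaNorm

namespace Summit.BirchSwinnertonDyer.Rank1Residual.Additive

section Twins

open TameBranchMuPart TameBranchAnalyticSha

variable {W : WeierstrassCurve ℚ} [W.IsElliptic] [W.IsGloballyMinimal] {p : ℕ} [hp : Fact p.Prime]

/-! ### §1 X4(M) ∩ {`ρ̄` onto}, every odd `p` -/

/-- **X4(M) MASTER: the upper half WITH `ℓ` and its equality case.** X4(M) ∩ {`ρ̄_{E,p}` onto}, EVERY odd `p`,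
`ord_{s=1} L(E,s) = 0`, a (B)-datum (`mainTheorem_potMult`), `#Ш_an(E) = s`; multiplicative twist data
`(V, C, f, ϖ)` (`C • V^{(p*)} = W`). Then for every cyclotomic dual datum: `X` torsion, `Ш[p^∞]` finite, and
the Kato element `g` (`ι g = u·ϖ·L^±_p(f, a_p(V))`) and Delbourgo's `ℓ ∣ p²` (`= 1` off anomalous) satisfy
**`ord_p #Ш(E/ℚ)[p^∞] + ord_p ℓ ≤ ord_p s`, EQUALITY ⟺ `char_Λ X = (g)`**. [cite: Kato2004Asterisque, Thm. 17.4 (3) (p. 273)]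
[cite: Wuthrich2014, Lemma 20 (p. 399)] [cite: Delbourgo2002, Theorem (B) (p. 40), p. 39]
[cite: GreenbergVatsal2000, p. 4] [cite: Miller2011LMS, §1 (arXiv:1010.2431 p. 3)] -/
theorem ClassX4M.padicVal_sha_add_le_shaAn_and_iff_rankZero
    (hK : Wuthrich2014.kato_halfEigenCharIdeal_dvd_cyclotomicPrime_of_surjective)
    (hGZK : rank_eq_analyticRank_of_analyticRank_le_one) (hmod : hasEntireLFunction_rat)
    (hX : ClassX4M W p) (hsurj : Surj W p) (hr : W.analyticRank = 0)
    {Dh : PAdicHeightData W p} (hBcl : LeadingTermClauses W p Dh) {s : ℚ} (hs : shaAn W = (s : ℂ))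
    (V : WeierstrassCurve ℚ) [V.IsElliptic] [V.IsGloballyMinimal] (C : VariableChange ℚ)
    (hC : C • V.quadraticTwist ((-1 : ℚ) ^ (p / 2) * p) = W) (hV : Mult V p)
    {N : ℕ} [NeZero N] {f : CuspForm (Gamma0 N) 2} (hf : IsNewformOf V f)
    (ϖ : ℚ) (hϖ : if Even (p / 2) then (ϖ : ℝ) * V.realPeriodRat = plusPeriod f
      else (ϖ : ℝ) * V.imaginaryPeriodRat = minusPeriod f)
    {κ : ZpExtension ℚ p} {γ : Field.absoluteGaloisGroup ℚ}
    (hκ : κ.IsCyclotomic) (hγ : κ.IsTopGenerator γ) (hγ' : IsCyclotomicVariable p γ)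
    (D : W.SelmerDualData κ γ) :
    D.IsTorsion ∧ Finite (AddCommGroup.primaryComponent W.sha p) ∧
      ∃ (g : IwasawaAlgebra p) (u : ℤ_[p]ˣ) (ℓ : ℕ), g ∈ D.charIdeal ∧
        iwasawaToPowerSeries p g = PowerSeries.C (((u : ℤ_[p]) : ℚ_[p]) * (ϖ : ℚ_[p])) *
          (if Even (p / 2) then padicLFunctionPlusBranchMult f ((V.LFunction p : ℤ) : ℚ_[p]) (p / 2)
            else padicLFunctionMinusBranchMult f ((V.LFunction p : ℤ) : ℚ_[p]) (p / 2)) ∧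
        ℓ ∣ p ^ 2 ∧ (ReductionNonAnomalous W p → ℓ = 1) ∧
        (padicValNat p (Nat.card (AddCommGroup.primaryComponent W.sha p)) : ℤ) + padicValNat p ℓ ≤
          padicValRat p s ∧
        (D.charIdeal = Ideal.span {g} ↔
          (padicValNat p (Nat.card (AddCommGroup.primaryComponent W.sha p)) : ℤ) + padicValNat p ℓ =
            padicValRat p s) := by
  have hp2 : p ≠ 2 := hX.p_ne_two
  have hadd : Addv W p := hX.1.2.1
  obtain ⟨hmw, -⟩ := hGZK W (by rw [hr]; norm_num)
  have hr0 : W.mordellWeilRank = 0 := by rw [hmw, hr]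
  have hL : W.entireLFunction 1 ≠ 0 := (W.analyticRank_eq_zero_iff_holds (hmod W)).mp hr
  have hsurjV : ∀ n : ℕ, V.HasSurjectiveModNGaloisRep (p ^ n : ℕ) :=
    (ClassX4M.potMult W p hX).towerSurj_twist_of_surj hp2 hsurj V C hC
  haveI : Module.Finite (IwasawaAlgebra p) D.X :=
    SelmerDualData.module_finite_of_isCyclotomic (W := W) (κ := κ) hκ D hγ
  obtain ⟨hap, -, -⟩ := cuspCoeff_eq_and_ne_zero_and_dvd_of_mult p hf hV
  obtain ⟨h0, hdict⟩ := valuation_constantCoeff_branchMult_add_eq_padicValRat_shaAn_add hmod hGZK hp2 hadd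
    hL V C hC hV hf hap ϖ hϖ hs
  have hbrick : D.IsTorsion ∧ ∃ g ∈ D.charIdeal, ∃ u : ℤ_[p]ˣ,
      iwasawaToPowerSeries p g = PowerSeries.C (((u : ℤ_[p]) : ℚ_[p]) * (ϖ : ℚ_[p])) *
        (if Even (p / 2) then padicLFunctionPlusBranchMult f ((V.LFunction p : ℤ) : ℚ_[p]) (p / 2)
          else padicLFunctionMinusBranchMult f ((V.LFunction p : ℤ) : ℚ_[p]) (p / 2)) := by
    by_cases hsp : V.HasSplitMultiplicativeReductionAtPrime p
    · have hap1 : V.LFunction p = 1 := by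
        have e : ((V.LFunction p : ℤ) : ℂ) = ((1 : ℤ) : ℂ) := by
          rw [← hap, (hf.cuspCoeff_eq_one_and_sq_of_split hsp).1, Int.cast_one]
        exact_mod_cast e
      rw [hap1]
      simpa only [Int.cast_one] using isTorsion_and_exists_iota_eq_of_katoHalf hK hp2 V C hC hsurjV hκ
        hγ hγ' hf D _ (Or.inr (Or.inl ⟨hsp, rfl⟩)) ϖ hϖ
    · have hap1 : V.LFunction p = -1 := by
        have e : ((V.LFunction p : ℤ) : ℂ) = ((-1 : ℤ) : ℂ) := by
          rw [← hap, (hf.cuspCoeff_eq_neg_one_and_dvd_of_nonsplit hV hsp).1, Int.cast_neg, Int.cast_one]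
        exact_mod_cast e
      rw [hap1]
      simpa only [Int.cast_neg, Int.cast_one] using isTorsion_and_exists_iota_eq_of_katoHalf hK hp2 V C
        hC hsurjV hκ hγ hγ' hf D _ (Or.inr (Or.inr ⟨hV, hsp, rfl⟩)) ϖ hϖ
  obtain ⟨hXt, g, hg, u, hι⟩ := hbrick
  obtain ⟨hfin, ℓ, hℓp, hℓ1, hle, hiff, -⟩ := padicVal_sha_add_le_and_iff_of_iota_eq_C_mul hr0 hBcl hκ hγ hγ' D
    hXt hg hι h0 hdict
  exact ⟨hXt, hfin, g, u, ℓ, hg, hι, hℓp, hℓ1, hle, hiff⟩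

/-- **X4(M): `BSD(E,p)` ⟹ THE KATO ELEMENT GENERATES `char_Λ X(E/ℚ_∞)`** (every odd `p`; for the given twist
datum and every cyclotomic dual datum). `BSD(E,p)` is a HYPOTHESIS; nothing booked.
[cite: Kato2004Asterisque, Thm. 17.4 (3) (p. 273)] [cite: Delbourgo2002, Theorem (B) (p. 40), p. 39]
[cite: Miller2011LMS, Def. 1.1 (arXiv:1010.2431 p. 3)] -/
theorem ClassX4M.charIdeal_eq_span_kato_of_bsdp_rankZero
    (hK : Wuthrich2014.kato_halfEigenCharIdeal_dvd_cyclotomicPrime_of_surjective)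
    (hGZK : rank_eq_analyticRank_of_analyticRank_le_one) (hmod : hasEntireLFunction_rat)
    (hX : ClassX4M W p) (hsurj : Surj W p) (hr : W.analyticRank = 0) (hBSD : BSDp W p)
    {Dh : PAdicHeightData W p} (hBcl : LeadingTermClauses W p Dh)
    (V : WeierstrassCurve ℚ) [V.IsElliptic] [V.IsGloballyMinimal] (C : VariableChange ℚ)
    (hC : C • V.quadraticTwist ((-1 : ℚ) ^ (p / 2) * p) = W) (hV : Mult V p)
    {N : ℕ} [NeZero N] {f : CuspForm (Gamma0 N) 2} (hf : IsNewformOf V f)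
    (ϖ : ℚ) (hϖ : if Even (p / 2) then (ϖ : ℝ) * V.realPeriodRat = plusPeriod f
      else (ϖ : ℝ) * V.imaginaryPeriodRat = minusPeriod f)
    {κ : ZpExtension ℚ p} {γ : Field.absoluteGaloisGroup ℚ}
    (hκ : κ.IsCyclotomic) (hγ : κ.IsTopGenerator γ) (hγ' : IsCyclotomicVariable p γ)
    (D : W.SelmerDualData κ γ) :
    ∃ (g : IwasawaAlgebra p) (u : ℤ_[p]ˣ), D.charIdeal = Ideal.span {g} ∧
      iwasawaToPowerSeries p g = PowerSeries.C (((u : ℤ_[p]) : ℚ_[p]) * (ϖ : ℚ_[p])) *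
        (if Even (p / 2) then padicLFunctionPlusBranchMult f ((V.LFunction p : ℤ) : ℚ_[p]) (p / 2)
          else padicLFunctionMinusBranchMult f ((V.LFunction p : ℤ) : ℚ_[p]) (p / 2)) := by
  obtain ⟨-, -, s, hs, hsv⟩ := hBSD
  obtain ⟨-, -, g, u, ℓ, -, hι, -, -, hle, hiff⟩ := ClassX4M.padicVal_sha_add_le_shaAn_and_iff_rankZero hK hGZK hmod
    hX hsurj hr hBcl hs V C hC hV hf ϖ hϖ hκ hγ hγ' D
  have hℓ0 : (padicValNat p ℓ : ℤ) = 0 := by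
    have h0 : (0 : ℤ) ≤ padicValNat p ℓ := by exact_mod_cast Nat.zero_le _
    rw [hsv] at hle; linarith
  exact ⟨g, u, hiff.mpr (by rw [hsv, hℓ0, add_zero]), hι⟩

/-- **X4(M), OFF THE ANOMALOUS ROWS: THE KATO ELEMENT GENERATES ⟹ `BSD(E,p)`** (every odd `p`). IF for
the multiplicative twist datum and every cyclotomic dual datum every Kato-shaped element (`g ∈ char_Λ X`,
`ι g = u·ϖ·L^±_p(f, a_p(V))`) generates `char_Λ X(E/ℚ_∞)`, then Miller's `BSD(E,p)` holds.
[cite: Kato2004Asterisque, Thm. 17.4 (3) (p. 273)] [cite: Delbourgo2002, Theorem (B) (p. 40), p. 39]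
[cite: Miller2011LMS, Def. 1.1 (arXiv:1010.2431 p. 3)] -/
theorem ClassX4M.bsdp_of_charIdeal_eq_span_kato_rankZero
    (hK : Wuthrich2014.kato_halfEigenCharIdeal_dvd_cyclotomicPrime_of_surjective)
    (hGZK : rank_eq_analyticRank_of_analyticRank_le_one) (hmod : hasEntireLFunction_rat)
    (hX : ClassX4M W p) (hsurj : Surj W p) (hr : W.analyticRank = 0) (hna : ReductionNonAnomalous W p)
    {Dh : PAdicHeightData W p} (hBcl : LeadingTermClauses W p Dh) {s : ℚ} (hs : shaAn W = (s : ℂ))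
    (V : WeierstrassCurve ℚ) [V.IsElliptic] [V.IsGloballyMinimal] (C : VariableChange ℚ)
    (hC : C • V.quadraticTwist ((-1 : ℚ) ^ (p / 2) * p) = W) (hV : Mult V p)
    {N : ℕ} [NeZero N] {f : CuspForm (Gamma0 N) 2} (hf : IsNewformOf V f)
    (ϖ : ℚ) (hϖ : if Even (p / 2) then (ϖ : ℝ) * V.realPeriodRat = plusPeriod f
      else (ϖ : ℝ) * V.imaginaryPeriodRat = minusPeriod f)
    (hMC : ∀ (κ : ZpExtension ℚ p) (γ : Field.absoluteGaloisGroup ℚ),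
      κ.IsCyclotomic → κ.IsTopGenerator γ → IsCyclotomicVariable p γ → ∀ (D : W.SelmerDualData κ γ)
      (g : IwasawaAlgebra p) (u : ℤ_[p]ˣ), g ∈ D.charIdeal →
        iwasawaToPowerSeries p g = PowerSeries.C (((u : ℤ_[p]) : ℚ_[p]) * (ϖ : ℚ_[p])) *
          (if Even (p / 2) then padicLFunctionPlusBranchMult f ((V.LFunction p : ℤ) : ℚ_[p]) (p / 2)
            else padicLFunctionMinusBranchMult f ((V.LFunction p : ℤ) : ℚ_[p]) (p / 2)) →
        D.charIdeal = Ideal.span {g}) :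
    BSDp W p := by
  obtain ⟨hmw, -⟩ := hGZK W (by rw [hr]; norm_num)
  obtain ⟨κ₀, γ₀, hκ₀, hγ₀, hγ₀', D₀, -, -⟩ := exists_cyclotomic_dualData_generator W p
  obtain ⟨-, hfin, g, u, ℓ, hg, hι, -, hℓ1, -, hiff⟩ := ClassX4M.padicVal_sha_add_le_shaAn_and_iff_rankZero hK hGZK
    hmod hX hsurj hr hBcl hs V C hC hV hf ϖ hϖ hκ₀ hγ₀ hγ₀' D₀
  have heq := hiff.mp (hMC κ₀ γ₀ hκ₀ hγ₀ hγ₀' D₀ g u hg hι)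
  rw [hℓ1 hna, padicValNat_one_right, Nat.cast_zero, add_zero] at heq
  exact ⟨hmw, hfin, s, hs, heq.symm⟩

/-! ### §2 X3♯(M) (`E[p]` reducible), every odd `p` -/

/-- **X3♯(M) MASTER: the upper half WITH `ℓ` and its equality case** for the Wuthrich element (`E[p]`
reducible, no image hypothesis), every odd `p`, rank 0, (B)-datum a binder, multiplicative twist data.
[cite: Wuthrich2014, Thm. 16 (p. 397)] [cite: Delbourgo2002, Theorem (B) (p. 40), p. 39]
[cite: GreenbergVatsal2000, p. 4] [cite: Miller2011LMS, §1 (arXiv:1010.2431 p. 3)] -/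
theorem ClassX3M.padicVal_sha_add_le_shaAn_and_iff_rankZero
    (hWu : Wuthrich2014.thm16_halfEigenCharIdeal_dvd_cyclotomicPrime)
    (hGZK : rank_eq_analyticRank_of_analyticRank_le_one) (hmod : hasEntireLFunction_rat)
    (hX : ClassX3M W p) (hr : W.analyticRank = 0)
    {Dh : PAdicHeightData W p} (hBcl : LeadingTermClauses W p Dh) {s : ℚ} (hs : shaAn W = (s : ℂ))
    (V : WeierstrassCurve ℚ) [V.IsElliptic] [V.IsGloballyMinimal] (C : VariableChange ℚ)
    (hC : C • V.quadraticTwist ((-1 : ℚ) ^ (p / 2) * p) = W) (hV : Mult V p)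
    {N : ℕ} [NeZero N] {f : CuspForm (Gamma0 N) 2} (hf : IsNewformOf V f)
    (ϖ : ℚ) (hϖ : if Even (p / 2) then (ϖ : ℝ) * V.realPeriodRat = plusPeriod f
      else (ϖ : ℝ) * V.imaginaryPeriodRat = minusPeriod f)
    {κ : ZpExtension ℚ p} {γ : Field.absoluteGaloisGroup ℚ}
    (hκ : κ.IsCyclotomic) (hγ : κ.IsTopGenerator γ) (hγ' : IsCyclotomicVariable p γ)
    (D : W.SelmerDualData κ γ) :
    D.IsTorsion ∧ Finite (AddCommGroup.primaryComponent W.sha p) ∧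
      ∃ (g : IwasawaAlgebra p) (u : ℤ_[p]ˣ) (ℓ : ℕ), g ∈ D.charIdeal ∧
        iwasawaToPowerSeries p g = PowerSeries.C (((u : ℤ_[p]) : ℚ_[p]) * (ϖ : ℚ_[p])) *
          (if Even (p / 2) then padicLFunctionPlusBranchMult f ((V.LFunction p : ℤ) : ℚ_[p]) (p / 2)
            else padicLFunctionMinusBranchMult f ((V.LFunction p : ℤ) : ℚ_[p]) (p / 2)) ∧
        ℓ ∣ p ^ 2 ∧ (ReductionNonAnomalous W p → ℓ = 1) ∧
        (padicValNat p (Nat.card (AddCommGroup.primaryComponent W.sha p)) : ℤ) + padicValNat p ℓ ≤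
          padicValRat p s ∧
        (D.charIdeal = Ideal.span {g} ↔
          (padicValNat p (Nat.card (AddCommGroup.primaryComponent W.sha p)) : ℤ) + padicValNat p ℓ =
            padicValRat p s) := by
  have hp2 : p ≠ 2 := hX.p_ne_two
  have hadd : Addv W p := hX.classX3.2
  obtain ⟨hmw, -⟩ := hGZK W (by rw [hr]; norm_num)
  have hr0 : W.mordellWeilRank = 0 := by rw [hmw, hr]
  have hL : W.entireLFunction 1 ≠ 0 := (W.analyticRank_eq_zero_iff_holds (hmod W)).mp hr
  have hirrV : ¬ V.HasIrreducibleModPGaloisRep p := fun hVirr ↦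
    hX.classX3.1 ((irr_iff_of_model_twist (W := V) (p := p) (pStar_ne_zero p) ⟨C, hC⟩).mpr hVirr)
  haveI : Module.Finite (IwasawaAlgebra p) D.X :=
    SelmerDualData.module_finite_of_isCyclotomic (W := W) (κ := κ) hκ D hγ
  obtain ⟨hap, -, -⟩ := cuspCoeff_eq_and_ne_zero_and_dvd_of_mult p hf hV
  obtain ⟨h0, hdict⟩ := valuation_constantCoeff_branchMult_add_eq_padicValRat_shaAn_add hmod hGZK hp2 hadd
    hL V C hC hV hf hap ϖ hϖ hs
  have hbrick : D.IsTorsion ∧ ∃ g ∈ D.charIdeal, ∃ u : ℤ_[p]ˣ,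
      iwasawaToPowerSeries p g = PowerSeries.C (((u : ℤ_[p]) : ℚ_[p]) * (ϖ : ℚ_[p])) *
        (if Even (p / 2) then padicLFunctionPlusBranchMult f ((V.LFunction p : ℤ) : ℚ_[p]) (p / 2)
          else padicLFunctionMinusBranchMult f ((V.LFunction p : ℤ) : ℚ_[p]) (p / 2)) := by
    by_cases hsp : V.HasSplitMultiplicativeReductionAtPrime p
    · have hap1 : V.LFunction p = 1 := by
        have e : ((V.LFunction p : ℤ) : ℂ) = ((1 : ℤ) : ℂ) := by
          rw [← hap, (hf.cuspCoeff_eq_one_and_sq_of_split hsp).1, Int.cast_one]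
        exact_mod_cast e
      rw [hap1]
      simpa only [Int.cast_one] using isTorsion_and_exists_iota_eq_of_wuthrichHalf hWu hp2 V C hC hirrV hκ
        hγ hγ' hf D _ (Or.inr (Or.inl ⟨hsp, rfl⟩)) ϖ hϖ
    · have hap1 : V.LFunction p = -1 := by
        have e : ((V.LFunction p : ℤ) : ℂ) = ((-1 : ℤ) : ℂ) := by
          rw [← hap, (hf.cuspCoeff_eq_neg_one_and_dvd_of_nonsplit hV hsp).1, Int.cast_neg, Int.cast_one]
        exact_mod_cast e
      rw [hap1]
      simpa only [Int.cast_neg, Int.cast_one] using isTorsion_and_exists_iota_eq_of_wuthrichHalf hWu hp2 V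
        C hC hirrV hκ hγ hγ' hf D _ (Or.inr (Or.inr ⟨hV, hsp, rfl⟩)) ϖ hϖ
  obtain ⟨hXt, g, hg, u, hι⟩ := hbrick
  obtain ⟨hfin, ℓ, hℓp, hℓ1, hle, hiff, -⟩ := padicVal_sha_add_le_and_iff_of_iota_eq_C_mul hr0 hBcl hκ hγ hγ' D
    hXt hg hι h0 hdict
  exact ⟨hXt, hfin, g, u, ℓ, hg, hι, hℓp, hℓ1, hle, hiff⟩

/-- **X3♯(M): `BSD(E,p)` ⟹ THE WUTHRICH ELEMENT GENERATES `char_Λ X(E/ℚ_∞)`** (every odd `p`).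
[cite: Wuthrich2014, Thm. 16 (p. 397)] [cite: Delbourgo2002, Theorem (B) (p. 40), p. 39]
[cite: Miller2011LMS, Def. 1.1 (arXiv:1010.2431 p. 3)] -/
theorem ClassX3M.charIdeal_eq_span_wuthrich_of_bsdp_rankZero
    (hWu : Wuthrich2014.thm16_halfEigenCharIdeal_dvd_cyclotomicPrime)
    (hGZK : rank_eq_analyticRank_of_analyticRank_le_one) (hmod : hasEntireLFunction_rat)
    (hX : ClassX3M W p) (hr : W.analyticRank = 0) (hBSD : BSDp W p)
    {Dh : PAdicHeightData W p} (hBcl : LeadingTermClauses W p Dh)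
    (V : WeierstrassCurve ℚ) [V.IsElliptic] [V.IsGloballyMinimal] (C : VariableChange ℚ)
    (hC : C • V.quadraticTwist ((-1 : ℚ) ^ (p / 2) * p) = W) (hV : Mult V p)
    {N : ℕ} [NeZero N] {f : CuspForm (Gamma0 N) 2} (hf : IsNewformOf V f)
    (ϖ : ℚ) (hϖ : if Even (p / 2) then (ϖ : ℝ) * V.realPeriodRat = plusPeriod f
      else (ϖ : ℝ) * V.imaginaryPeriodRat = minusPeriod f)
    {κ : ZpExtension ℚ p} {γ : Field.absoluteGaloisGroup ℚ}
    (hκ : κ.IsCyclotomic) (hγ : κ.IsTopGenerator γ) (hγ' : IsCyclotomicVariable p γ)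
    (D : W.SelmerDualData κ γ) :
    ∃ (g : IwasawaAlgebra p) (u : ℤ_[p]ˣ), D.charIdeal = Ideal.span {g} ∧
      iwasawaToPowerSeries p g = PowerSeries.C (((u : ℤ_[p]) : ℚ_[p]) * (ϖ : ℚ_[p])) *
        (if Even (p / 2) then padicLFunctionPlusBranchMult f ((V.LFunction p : ℤ) : ℚ_[p]) (p / 2)
          else padicLFunctionMinusBranchMult f ((V.LFunction p : ℤ) : ℚ_[p]) (p / 2)) := by
  obtain ⟨-, -, s, hs, hsv⟩ := hBSD
  obtain ⟨-, -, g, u, ℓ, -, hι, -, -, hle, hiff⟩ := ClassX3M.padicVal_sha_add_le_shaAn_and_iff_rankZero hWu hGZK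
    hmod hX hr hBcl hs V C hC hV hf ϖ hϖ hκ hγ hγ' D
  have hℓ0 : (padicValNat p ℓ : ℤ) = 0 := by
    have h0 : (0 : ℤ) ≤ padicValNat p ℓ := by exact_mod_cast Nat.zero_le _
    rw [hsv] at hle; linarith
  exact ⟨g, u, hiff.mpr (by rw [hsv, hℓ0, add_zero]), hι⟩

/-- **X3♯(M), OFF THE ANOMALOUS ROWS: THE WUTHRICH ELEMENT GENERATES ⟹ `BSD(E,p)`** (every odd `p`).
[cite: Wuthrich2014, Thm. 16 (p. 397)] [cite: Delbourgo2002, Theorem (B) (p. 40), p. 39]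
[cite: Miller2011LMS, Def. 1.1 (arXiv:1010.2431 p. 3)] -/
theorem ClassX3M.bsdp_of_charIdeal_eq_span_wuthrich_rankZero
    (hWu : Wuthrich2014.thm16_halfEigenCharIdeal_dvd_cyclotomicPrime)
    (hGZK : rank_eq_analyticRank_of_analyticRank_le_one) (hmod : hasEntireLFunction_rat)
    (hX : ClassX3M W p) (hr : W.analyticRank = 0) (hna : ReductionNonAnomalous W p)
    {Dh : PAdicHeightData W p} (hBcl : LeadingTermClauses W p Dh) {s : ℚ} (hs : shaAn W = (s : ℂ))
    (V : WeierstrassCurve ℚ) [V.IsElliptic] [V.IsGloballyMinimal] (C : VariableChange ℚ)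
    (hC : C • V.quadraticTwist ((-1 : ℚ) ^ (p / 2) * p) = W) (hV : Mult V p)
    {N : ℕ} [NeZero N] {f : CuspForm (Gamma0 N) 2} (hf : IsNewformOf V f)
    (ϖ : ℚ) (hϖ : if Even (p / 2) then (ϖ : ℝ) * V.realPeriodRat = plusPeriod f
      else (ϖ : ℝ) * V.imaginaryPeriodRat = minusPeriod f)
    (hMC : ∀ (κ : ZpExtension ℚ p) (γ : Field.absoluteGaloisGroup ℚ),
      κ.IsCyclotomic → κ.IsTopGenerator γ → IsCyclotomicVariable p γ → ∀ (D : W.SelmerDualData κ γ)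
      (g : IwasawaAlgebra p) (u : ℤ_[p]ˣ), g ∈ D.charIdeal →
        iwasawaToPowerSeries p g = PowerSeries.C (((u : ℤ_[p]) : ℚ_[p]) * (ϖ : ℚ_[p])) *
          (if Even (p / 2) then padicLFunctionPlusBranchMult f ((V.LFunction p : ℤ) : ℚ_[p]) (p / 2)
            else padicLFunctionMinusBranchMult f ((V.LFunction p : ℤ) : ℚ_[p]) (p / 2)) →
        D.charIdeal = Ideal.span {g}) :
    BSDp W p := by
  obtain ⟨hmw, -⟩ := hGZK W (by rw [hr]; norm_num)
  obtain ⟨κ₀, γ₀, hκ₀, hγ₀, hγ₀', D₀, -, -⟩ := exists_cyclotomic_dualData_generator W p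
  obtain ⟨-, hfin, g, u, ℓ, hg, hι, -, hℓ1, -, hiff⟩ := ClassX3M.padicVal_sha_add_le_shaAn_and_iff_rankZero hWu hGZK
    hmod hX hr hBcl hs V C hC hV hf ϖ hϖ hκ₀ hγ₀ hγ₀' D₀
  have heq := hiff.mp (hMC κ₀ γ₀ hκ₀ hγ₀ hγ₀' D₀ g u hg hι)
  rw [hℓ1 hna, padicValNat_one_right, Nat.cast_zero, add_zero] at heq
  exact ⟨hmw, hfin, s, hs, heq.symm⟩

end Twins

end Summit.BirchSwinnertonDyer.Rank1Residual.Additive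

end
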